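import Summits.NavierStokesRegularity.NavierStokesRegularity.Theses.TypeIQuarterGate
import Summits.NavierStokesRegularity.NavierStokesRegularity.Theorems.TypeIQuarterGateLorentzBoundOfEnvelope
import Summits.NavierStokesRegularity.NavierStokesRegularity.Theorems.TypeICertificateLadderRungReynoldsOneTaoCover
import Literature.Analysis.FluidPDE.NSCriticalClosureTao
import Literature.Analysis.FluidPDE.LerayHopfConcatenation
import HarnessLib

/-!
# `TypeIQuarterGate`: the Lorentz (weak-`L³`) Type-I bound localises at the blow-up time

Helper for the crux `QuarterLawTypeI` (stmt-NavierStokesRegularity-23726), registered line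
`lorentz-upgrade`, open stub `stub_lorentzUpgrade` = item `LorentzUpgradeTypeI` (24108):
`∃ M', ∀ t ∈ [0,T), sup_λ λ³|{λ < ‖u(t)‖}| ≤ M'` for a maximal smooth Leray–Hopf solution from a
rapidly decaying datum with the sup-norm Type-I rate at `T`.

**Content (the early times are free).**
* `eWeakLpPow_three_le_of_norm_le` — a BOUNDED `L²` slice is weak-`L³`:
  `‖v‖ ≤ B`, `∫‖v‖² ≤ E` ⟹ `sup_λ λ³|{λ < ‖v‖}| ≤ B·E` (levels `λ ≥ B` are empty, levels `λ < B` pay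
  `λ · λ²|{λ<‖v‖}| ≤ λ E ≤ B E` by Chebyshev).
* `lorentzBound_of_eventually` — for a classical solution on `[0,T)` that is Leray–Hopf from its
  rapidly decaying datum, a weak-`L³` bound on a final window `[t₀, T)` extends to all of `[0,T)`:
  on `[0, t₀]` the solution lies in Tao's class (tree: `RungReynoldsOne.stub_taoCover`, all Sobolev
  norms bounded on compact sub-slabs) hence is bounded (Sobolev imbedding, tree:
  `exists_forall_norm_le_of_hasBoundedSobolevNormsOn`), and the energy bound `∫‖u(t)‖² ≤ 2E(u₀)`
  closes with the first bullet.  So the OPEN content of `LorentzUpgradeTypeI` is exactly its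
  EVENTUAL form at `T` (`lorentzBound_iff_eventually`).
* `eWeakLpPow_three_le_of_typeI_rate` — the benchmark the open stub must beat: the rate
  `‖u(t)‖_∞ ≤ C/√(T−t)` and the energy give only `sup_λ λ³|{λ<‖u(t)‖}| ≤ C·2E(u₀)/√(T−t)`, the
  weak-`L³` cube AT THE TYPE-I RATE, not uniformly (the enemy: intermediate-amplitude clouds,
  `λ ≍ M/√(T−t)` on volume `≫ λ⁻³`; cf. the docstring of `LorentzUpgradeTypeI`).

HONEST FRAMING: bookkeeping along a HYPOTHETICAL blow-up; `LorentzUpgradeTypeI` / `QuarterLawTypeI`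
remain OPEN; nothing about Navier–Stokes regularity or blow-up is claimed.

References: Grafakos, *Classical Fourier Analysis* §1.1; Leray 1934 §31; Tao 2013 Thm 5.4.
[folklore]
-/

-- the problem directory repeats the summit name (`NavierStokesRegularity/NavierStokesRegularity`)
set_option linter.dupNamespace false

noncomputable section

open Set Filter MeasureTheory Topology Metric
open scoped ENNReal NNReal

namespace Summit.NavierStokesRegularity.NavierStokesRegularity.Theorems

namespace LorentzOfEnvelope

open Literature.Analysis.FluidPDE Literature.Analysis.FunctionSpaces

/-! ### A bounded `L²` slice is weak-`L³` -/

/-- **Bounded + `L²` ⟹ weak-`L³`**: if `‖v‖ ≤ B` everywhere and `∫ ‖v‖² ≤ E`, then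
`sup_λ λ³ |{λ < ‖v‖}| ≤ B·E`. [folklore] -/
theorem eWeakLpPow_three_le_of_norm_le
    {v : EuclideanSpace ℝ (Fin 3) → EuclideanSpace ℝ (Fin 3)} (hv : AEStronglyMeasurable v volume)
    {B E : ℝ} (hB : ∀ x, ‖v x‖ ≤ B) (hE : ∫⁻ x, ‖v x‖ₑ ^ 2 ≤ ENNReal.ofReal E) :
    eWeakLpPow v 3 volume ≤ ENNReal.ofReal (B * E) := by
  have h3 : (0 : ℝ) < (3 : ℝ≥0∞).toReal := by norm_num
  refine Wu2026Salvage.eWeakLpPow_le_of_forall h3 fun lam hlam => ?_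
  have e3 : ENNReal.ofReal (lam ^ (3 : ℝ≥0∞).toReal) = ENNReal.ofReal (lam ^ 3) := by
    norm_num
  rw [e3]
  rcases le_or_gt B lam with hhigh | hlow
  · -- empty superlevel set
    have hempty : {x | lam < ‖v x‖} = ∅ :=
      eq_empty_of_forall_notMem fun x hx => absurd (lt_of_lt_of_le hx (hB x)) (not_lt.2 hhigh)
    rw [hempty, measure_empty, mul_zero]
    exact zero_le
  · have hcheb := sq_mul_meas_superlevel_le_lintegral hv hlam
    have hsplit : ENNReal.ofReal (lam ^ 3) = ENNReal.ofReal lam * ENNReal.ofReal (lam ^ 2) := by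
      rw [← ENNReal.ofReal_mul hlam.le]; ring_nf
    have hB0 : 0 ≤ B := (norm_nonneg (v 0)).trans (hB 0)
    calc ENNReal.ofReal (lam ^ 3) * volume {x | lam < ‖v x‖}
        = ENNReal.ofReal lam * (ENNReal.ofReal (lam ^ 2) * volume {x | lam < ‖v x‖}) := by
          rw [hsplit, mul_assoc]
      _ ≤ ENNReal.ofReal B * ENNReal.ofReal E :=
          mul_le_mul' (ENNReal.ofReal_le_ofReal hlow.le) (hcheb.trans hE)
      _ = ENNReal.ofReal (B * E) := (ENNReal.ofReal_mul hB0).symm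

/-! ### The energy bound of the slices -/

/-- `∫ ‖u(t)‖ₑ² ≤ ofReal (2 E(u₀))` on `[0,T]` for an unforced Leray–Hopf solution (`ν ≥ 0`).
[cite: Leray1934, §31] -/
theorem lintegral_sq_le_of_isLerayHopfOn {ν T : ℝ} (hν : 0 ≤ ν)
    {u : ℝ → EuclideanSpace ℝ (Fin 3) → EuclideanSpace ℝ (Fin 3)}
    (hLH : IsLerayHopfOn T ν 0 (u 0) u) {t : ℝ} (ht : t ∈ Icc 0 T) :
    ∫⁻ x, ‖u t x‖ₑ ^ 2 ≤ ENNReal.ofReal (2 * VectorCalculus.kineticEnergy (u 0)) := by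
  have hmem : MemLp (u t) 2 volume := hLH.memLp t ht
  have h1 : eEnergy (u t) = ENNReal.ofReal (2 * VectorCalculus.kineticEnergy (u t)) :=
    eEnergy_eq_ofReal _ hmem
  have h2 : VectorCalculus.kineticEnergy (u t) ≤ VectorCalculus.kineticEnergy (u 0) :=
    hLH.kineticEnergy_le_of_zero_force hν ht
  calc ∫⁻ x, ‖u t x‖ₑ ^ 2 = eEnergy (u t) := rfl
    _ = ENNReal.ofReal (2 * VectorCalculus.kineticEnergy (u t)) := h1
    _ ≤ ENNReal.ofReal (2 * VectorCalculus.kineticEnergy (u 0)) :=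
        ENNReal.ofReal_le_ofReal (by linarith)

/-! ### The early times are free: eventual ⟹ global -/

/-- **The weak-`L³` bound localises at `T`.** For a classical solution of the unforced system on
`[0,T)` (`ν > 0`), Leray–Hopf from its rapidly decaying datum, a weak-`L³` bound on a final window
`[t₀,T)` extends to `[0,T)`: before `t₀` the solution is in Tao's class, hence bounded, and a
bounded `L²` slice is weak-`L³`. [cite: Tao2011, Thm. 5.4 (i)+(iv)] -/
theorem lorentzBound_of_eventually {ν T : ℝ} (hν : 0 < ν) (hT : 0 < T)
    {u : ℝ → EuclideanSpace ℝ (Fin 3) → EuclideanSpace ℝ (Fin 3)}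
    {p : ℝ → EuclideanSpace ℝ (Fin 3) → ℝ}
    (hsol : IsClassicalNSSolutionOn (Ico 0 T) ν 0 u p) (hLH : IsLerayHopfOn T ν 0 (u 0) u)
    (hdec : HasRapidSpatialDecay (u 0))
    (hev : ∃ M t₀ : ℝ, t₀ < T ∧ ∀ t ∈ Ico t₀ T, eWeakLpPow (u t) 3 volume ≤ ENNReal.ofReal M) :
    ∃ M' : ℝ, ∀ t ∈ Ico 0 T, eWeakLpPow (u t) 3 volume ≤ ENNReal.ofReal M' := by
  obtain ⟨M, t₀, ht₀T, hM⟩ := hev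
  rcases le_or_gt t₀ 0 with ht₀ | ht₀
  · exact ⟨M, fun t ht => hM t ⟨ht₀.trans ht.1, ht.2⟩⟩
  -- `0 < t₀ < T`: Tao's class on `[0, t₀]`
  obtain ⟨q, hsolq, hBq, -, -⟩ := RungReynoldsOne.stub_taoCover hν hT hsol hLH hdec ⟨ht₀, ht₀T⟩
  obtain ⟨B, hB0, hB⟩ := exists_forall_norm_le_of_hasBoundedSobolevNormsOn hsolq hBq
  set E : ℝ := 2 * VectorCalculus.kineticEnergy (u 0) with hE_def
  refine ⟨max M (B * E), fun t ht => ?_⟩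
  rcases lt_or_ge t t₀ with htt₀ | htt₀
  · -- early time
    have htI : t ∈ Icc 0 t₀ := ⟨ht.1, htt₀.le⟩
    have hmem : MemLp (u t) 2 volume := hLH.memLp t ⟨ht.1, ht.2.le⟩
    calc eWeakLpPow (u t) 3 volume ≤ ENNReal.ofReal (B * E) :=
          eWeakLpPow_three_le_of_norm_le hmem.1 (hB t htI)
            (lintegral_sq_le_of_isLerayHopfOn hν.le hLH ⟨ht.1, ht.2.le⟩)
      _ ≤ ENNReal.ofReal (max M (B * E)) := ENNReal.ofReal_le_ofReal (le_max_right _ _)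
  · exact (hM t ⟨htt₀, ht.2⟩).trans (ENNReal.ofReal_le_ofReal (le_max_left _ _))

/-- **`LorentzUpgradeTypeI`'s conclusion ⟺ its eventual form**, along any classical solution on
`[0,T)` that is Leray–Hopf from a rapidly decaying datum (`ν, T > 0`). [folklore] -/
theorem lorentzBound_iff_eventually {ν T : ℝ} (hν : 0 < ν) (hT : 0 < T)
    {u : ℝ → EuclideanSpace ℝ (Fin 3) → EuclideanSpace ℝ (Fin 3)}
    {p : ℝ → EuclideanSpace ℝ (Fin 3) → ℝ}
    (hsol : IsClassicalNSSolutionOn (Ico 0 T) ν 0 u p) (hLH : IsLerayHopfOn T ν 0 (u 0) u)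
    (hdec : HasRapidSpatialDecay (u 0)) :
    (∃ M' : ℝ, ∀ t ∈ Ico 0 T, eWeakLpPow (u t) 3 volume ≤ ENNReal.ofReal M') ↔
      ∃ M t₀ : ℝ, t₀ < T ∧ ∀ t ∈ Ico t₀ T, eWeakLpPow (u t) 3 volume ≤ ENNReal.ofReal M :=
  ⟨fun ⟨M', h⟩ => ⟨M', 0, hT, h⟩, lorentzBound_of_eventually hν hT hsol hLH hdec⟩

/-! ### The benchmark: the weak-`L³` cube at the Type-I rate (free, not uniform) -/

/-- **The rate alone gives the cube at the Type-I rate.** If `‖u(t,x)‖ ≤ C/√(T−t)` at a time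
`t ∈ [0,T)` of an unforced Leray–Hopf solution, then `sup_λ λ³|{λ<‖u(t)‖}| ≤ C·2E(u₀)/√(T−t)` —
the TRIVIAL weak-`L³` bound, blowing up at the Type-I rate; `LorentzUpgradeTypeI` asks for a bound
uniform in `t`. [folklore] -/
theorem eWeakLpPow_three_le_of_typeI_rate {ν T : ℝ} (hν : 0 ≤ ν)
    {u : ℝ → EuclideanSpace ℝ (Fin 3) → EuclideanSpace ℝ (Fin 3)}
    (hLH : IsLerayHopfOn T ν 0 (u 0) u) {C t : ℝ} (ht : t ∈ Ico 0 T)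
    (hrate : ∀ x, ‖u t x‖ ≤ C / Real.sqrt (T - t)) :
    eWeakLpPow (u t) 3 volume ≤
      ENNReal.ofReal (C / Real.sqrt (T - t) * (2 * VectorCalculus.kineticEnergy (u 0))) :=
  eWeakLpPow_three_le_of_norm_le (hLH.memLp t (Ico_subset_Icc_self ht)).1 hrate
    (lintegral_sq_le_of_isLerayHopfOn hν hLH (Ico_subset_Icc_self ht))

/-! ### By name: `LorentzUpgradeTypeI` is its own eventual form -/

open Summit.NavierStokesRegularity.NavierStokesRegularity.Theses.TypeIQuarterGate in
/-- **`LorentzUpgradeTypeI` (item 24108 = stub `stub_lorentzUpgrade`) follows from its EVENTUAL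
form at the blow-up time**: it suffices to bound the weak-`L³` slices on some final window
`[t₀, T)`; the early times are supplied by Tao's class and the energy
(`lorentzBound_of_eventually`). [folklore] -/
theorem lorentzUpgradeTypeI_of_eventual
    (h : ∀ (ν T : ℝ), 0 < ν → 0 < T →
      ∀ (u : ℝ → EuclideanSpace ℝ (Fin 3) → EuclideanSpace ℝ (Fin 3))
        (p : ℝ → EuclideanSpace ℝ (Fin 3) → ℝ),
        IsMaximalSmoothSolution ν 0 u p T → IsLerayHopfOn T ν 0 (u 0) u →
        HasRapidSpatialDecay (u 0) → IsTypeIBlowup u T →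
        ∃ M t₀ : ℝ, t₀ < T ∧ ∀ t ∈ Ico t₀ T, eWeakLpPow (u t) 3 volume ≤ ENNReal.ofReal M) :
    LorentzUpgradeTypeI := by
  intro ν T hν hT u p hmax hLH hdec hI
  exact lorentzBound_of_eventually hν hT hmax.1 hLH hdec (h ν T hν hT u p hmax hLH hdec hI)

open Summit.NavierStokesRegularity.NavierStokesRegularity.Theses.TypeIQuarterGate in
/-- Conversely (trivially) `LorentzUpgradeTypeI` gives its eventual form. [folklore] -/
theorem eventual_of_lorentzUpgradeTypeI (h : LorentzUpgradeTypeI) :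
    ∀ (ν T : ℝ), 0 < ν → 0 < T →
      ∀ (u : ℝ → EuclideanSpace ℝ (Fin 3) → EuclideanSpace ℝ (Fin 3))
        (p : ℝ → EuclideanSpace ℝ (Fin 3) → ℝ),
        IsMaximalSmoothSolution ν 0 u p T → IsLerayHopfOn T ν 0 (u 0) u →
        HasRapidSpatialDecay (u 0) → IsTypeIBlowup u T →
        ∃ M t₀ : ℝ, t₀ < T ∧ ∀ t ∈ Ico t₀ T, eWeakLpPow (u t) 3 volume ≤ ENNReal.ofReal M := by
  intro ν T hν hT u p hmax hLH hdec hI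
  obtain ⟨M', hM'⟩ := h ν T hν hT u p hmax hLH hdec hI
  exact ⟨M', 0, hT, hM'⟩

/-- **The trivial benchmark along a Type-I blow-up, by name**: under `IsTypeIBlowup u T` the
weak-`L³` cube of an unforced Leray–Hopf solution is eventually `≤ C·2E(u₀)/√(T−t)` — bounded at
the Type-I RATE, which is what the sup-norm rate and the energy give for free; the open stub asks
for `O(1)`. [folklore] -/
theorem eventually_eWeakLpPow_three_le_rate {ν T : ℝ} (hν : 0 ≤ ν) (hT : 0 < T)
    {u : ℝ → EuclideanSpace ℝ (Fin 3) → EuclideanSpace ℝ (Fin 3)}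
    (hLH : IsLerayHopfOn T ν 0 (u 0) u) (hI : IsTypeIBlowup u T) :
    ∃ C : ℝ, ∀ᶠ t in 𝓝[<] T, eWeakLpPow (u t) 3 volume ≤
      ENNReal.ofReal (C / Real.sqrt (T - t) * (2 * VectorCalculus.kineticEnergy (u 0))) := by
  obtain ⟨C, hC⟩ := hI
  refine ⟨C, ?_⟩
  filter_upwards [hC, Ioo_mem_nhdsLT hT] with t ht htI
  exact eWeakLpPow_three_le_of_typeI_rate hν hLH ⟨htI.1.le, htI.2⟩ ht

end LorentzOfEnvelope

end Summit.NavierStokesRegularity.NavierStokesRegularity.Theorems
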